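import Summits.AtomisticToContinuum.FouriersLaw.Theses.OddSectorIrreversibility
import Literature.MathematicalPhysics.KineticTheory.OddSectorLocalityHypothesis

/-!
# Disproof of `OddCorrectorDecay` — findings (cdisprove, gen 1, cycle 1; 2026-08-16)

Crux `stmt-AtomisticToContinuum-9139`, decl `OddSectorIrreversibility.OddCorrectorDecay` (rank 2,
the route's ENGINE): for all `ω₂, lam, β, γ, T > 0` there is `C` with, for EVERY `N`,
`t ↦ F_N(t) := ‖P_tJ - (P_tJ)∘Θ‖_{L²(μ_T)}` integrable on `(0,∞)` and `∫₀^∞ F_N ≤ C‖J‖_{L²(μ_T)}`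
(`J = J_tot`, `P_t` = `OscillatorChain.transitionKernel N T T t` the equilibrium kernels,
`μ_T = e^{-H_N/T}dqdp`, `Θ(q,p) = (q,-p)`).

## VERDICT: FALSE at every admissible parameter point — by LOCALITY, not by slow hydrodynamics.
Kernel-checked MODULO `H` (negative lemma `oddCorrectorDecay_false_of_oddSectorLocalityHypothesis`;
`H` = the Literature named fact `Literature.MathematicalPhysics.KineticTheory.OddSectorLocalityHypothesis`
(p73821 ACCEPTED, commit df9780857703); the lemma LANDED as
`Summits/AtomisticToContinuum/FouriersLaw/Theorems/OddCorrectorDecay/Negative/FalseOfLocality.lean`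
(p73979 ACCEPTED, commit 440eba24d006 — importable: `Summit.AtomisticToContinuum.FouriersLaw.Theorems.OddSectorLocality.*`); the unconditional `¬` waits
for `H` = the `L²(μ_T)` dictionary of the chain + fixed-time memory (§4), none of which the tree can
construct today. The route is NOT dead: its own kill criterion (c) applies verbatim (§5).

## §0 Typed-statement audit (independent re-read)
* Elaborates (`W.lean` rc 0, one sorry). `oddCorrectorDecay_iff` below restates it through
  `oddPartNormSq` / `currentNormSq` by `Iff.rfl` — no transcription drift.
* No junk escape: `transitionKernel` is the honest law of the SDE flow for `ω₂ > 0`, `lam, β, γ ≥ 0`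
  (`pinnedChain_transitionKernel_apply`); all Bochner integrals involved ARE integrals in the model
  (polynomial observables, Lyapunov moments; unnormalised weight has finite mass). `N = 0, 1`:
  `J ≡ 0`, both sides `0`, clause true. `T ≤ 0` is excluded; dropping `0 < T` makes the clause
  junk-TRUE (`T < 0`: weight `e^{+H/|T|}`, every integral is Bochner-`0`), so `0 < T` is not
  load-bearing for falsity.
* Quantifiers: `∃ C ∀ N` per `(ω₂, lam, β, γ, T)` — `C` may blow up in the harmonic / cold corner;
  only `N`-uniformity is claimed. The obstruction below is `N`-uniformity itself.

## §1 The obstruction (unitarity of the deterministic bulk + locality of the boundary noise)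
Notation: `M_N = ‖J‖²` (`currentNormSq`, `≍ N`), `A_N(t) = ‖P_tJ‖²` (`forecastNormSq`),
`B_N(u) = ⟨J, P_uJ⟩` (`currentAutocorr`, the Green–Kubo integrand), `F_N(t)²` (`oddPartNormSq`).
1. GENERALISED DETAILED BALANCE `P_t* = ΘP_tΘ` on `L²(μ_T)` (`L† = ΘLΘ`, Kundu–Dhar–Narayan
   (reln2) — the identity the route itself uses in `OddDensityIsCorrector`) + `Θ`-invariance of
   `μ_T` + `J∘Θ = -J` give the EXACT identity `F_N(t)² = 2A_N(t) + 2B_N(2t)`: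
   `⟨P_tJ, ΘP_tJ⟩ = ⟨J, P_t*ΘP_tJ⟩ = ⟨J, ΘP_{2t}J⟩ = ⟨ΘJ, P_{2t}J⟩ = -B_N(2t)`.
   So NORM decay of the odd part of `P_tJ` is norm decay of `P_tJ` ITSELF, up to the autocorrelation.
2. `u ↦ B_N(|u|)` is positive-definite (stationary autocovariance), so in Fejér form
   `∫₀^S (S-u)B_N(u)du = ½E(∫₀^S J(X_s)ds)² ≥ 0`: the cross term cannot help on average.
3. Contraction (`μ_T` is `P_t`-invariant): `A_N ↓`, `A_N, B_N ≤ M_N`, hence `F_N ≤ 2√M_N` and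
   `F_N ≥ F_N²/(2√M_N)`.
4. 1–3 + the crux ⟹ (`horizon_le_of_integrated_odd_decay`, PROVED, pure real analysis with the Fejér
   weight `1 - t/S`):  `C√M ≥ ∫₀^S(1-t/S)F ≥ (∫₀^S(1-t/S)A + ∫₀^S(1-t/S)B(2·))/√M ≥ (S/2)A(S)/√M`,
   i.e. **`A_N(S) ≤ 2C·M_N/S` for all `S, N`**: the two boundary Brownian motions would have to
   erase HALF of the `L²(μ_T)`-norm² of the total current by the FIXED time `4C`, uniformly in `N`.
5. LOCALITY: they cannot. Exactly, `M_N - A_N(t) = E_μ Var(J(X_t) | X_0) =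
   2γT ∫₀ᵗ ∑_{b∈{0,N-1}} ‖∂_{p_b}P_sJ‖² ds` (the `L²(μ_T)` dissipation identity: the antisymmetric
   Liouville part is invisible, only the two OU directions dissipate). The bulk is deterministic,
   its Koopman evolution UNITARY on `L²(μ_T)`; `∂_{p_b}P_sJ = ∑_z ∂_{p_b}P_s j_z` is carried by the
   bonds the boundary perturbation has reached by time `s` (propagation bounds for anharmonic
   lattices: Marchioro–Pellegrinotti–Pulvirenti–Triolo 1978, Buttà–Caglioti–Di Ruzza–Marchioro
   2007; Gibbs-typical local energies are `O(log N)`), so `M_N - A_N(t) = O_t(1)·N^{o(1)}` while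
   `M_N ≍ N`: `A_N(t)/M_N → 1` at every fixed `t`. Contradiction with 4.
Physically `A_N(t) ≈ σ²(N - 2v_Bt)₊` (butterfly fronts from both contacts), `∫₀^∞F_N ≍ N^{3/2}`,
`∫F_N/‖J‖ ≍ N` — the SAME order the route file records for the harmonic member ("grows at least
linearly in N"): that growth was never "ballistic phonons", it is causality, and anharmonic
dephasing cannot touch it. The planner's budget (`t^{-3/4}` tail, "marginal but consistent")
estimated CORRELATIONS `⟨P_tJ, g⟩` against hydrodynamic `g`; the crux demands the NORM
`sup_{‖g‖=1, g odd} ⟨P_tJ, g⟩`, attained by `g ∝ P_odd(J∘φ_t)`-type functions of unit norm that no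
hydrodynamic heuristic sees. (iii) of the item's own "why it might fail" ("the NORM is integrated")
is the operative failure, in a far stronger form than a slow tail: no decay at all before contact.

## §2 What is PROVED (sorry-free, standard axioms) — now IN THE TREE, imported here
* `Literature/MathematicalPhysics/KineticTheory/OddSectorLocalityHypothesis.lean` (p73821): the objects
  `OddSectorLocality.{gibbsWeight, currentForecast, oddPartNormSq, currentNormSq, forecastNormSq,
  currentAutocorr}` (verbatim the crux's expressions), `currentForecast_zero` (`P_0 = id`),
  `forecastNormSq_zero` (`A_N(0) = M_N`), and the named fact `OddSectorLocalityHypothesis` (`H`).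
* `Theorems/OddCorrectorDecay/Negative/FalseOfLocality.lean` (p73979), namespace
  `Summit.AtomisticToContinuum.FouriersLaw.Theorems.OddSectorLocality`:
  `horizon_le_of_integrated_odd_decay` (the real-analysis core, §1.4), `oddCorrectorDecay_iff`
  (`Iff.rfl`), `oddCorrectorDecay_false_of_dictionary_of_memory` (dictionary (1)–(4) + memory as
  explicit hypotheses ⟹ `¬` crux), `oddCorrectorDecay_false_of_oddSectorLocalityHypothesis :
  H → ¬ OddCorrectorDecay` (the negative lemma).
* This file (v2b, self-contained while the farm builds the new Negative module; v3 will simply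
  import it) re-declares the same four theorems VERBATIM under the `…Cruxes.OddCorrectorDecay.Disproof`
  namespace, and adds `horizon_le_four_mul_constant` — TIGHTNESS, one `N` at a time: any admissible
  `C ≥ t_½(N)/4`, `t_½(N)` the half-life of `A_N` (numerically `≈ N/2` anharmonic, `≈ 0.8N`
  harmonic, §6) — plus the sorried near-miss `not_oddCorrectorDecay` (obstruction = `H`).

## §3 Load-bearing hypotheses of the crux (for falsity)
* `0 < γ`: at `γ = 0` the kernels are the deterministic Hamiltonian flow, `A_N(t) = M_N` for all
  `t` (unitarity), and §1.4 gives `S ≤ 4C` for EVERY `S`: the clause fails at each single `N ≥ 2`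
  (`∫₀^∞F_N = ∞`; indeed `F_N(t)² = 2M_N + 2B_N(2t) → 2M_N` if mixing). Same dictionary needed, so
  recorded, not filed. `γ > 0` only localises this failure to the bulk: it is the SAME mechanism.
* `0 < lam`, `0 < β`: NOT load-bearing for falsity — the harmonic corner fails too (route file,
  exact Gaussian algebra: ratio linear in `N`), by the same causality count.
* `0 < ω₂`: needed only for the kernels to be the honest flow (measurability proofs in tree assume
  `ω₂ > 0`); at `ω₂ ≤ 0` with `lam > 0` the physics is unchanged (double well), the Lean kernel may
  be the junk `0` ⟹ clause junk-true. Not an attack surface.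
* `0 < T`: not load-bearing (junk-true for `T ≤ 0`, §0).
* HIDDEN load-bearing choice: "integral of the norm" (rank 2) versus "norm of the integral"
  (rank 3 / SI′). Only the former is hit.

## §4 Why no UNCONDITIONAL kill yet — exactly what `H` asks of the tree
`H = OddSectorLocalityHypothesis` (∃ an admissible parameter point with, for all `N`):
(1) `t ↦ ‖P_tJ‖²_{L²(μ_T)}` antitone on `[0,∞)` — needs: `μ_T` INVARIANT under the constructed
kernels (the tree has only weak stationarity `∫Lf dμ_T = 0` on `C_c^∞`,
`pinnedChain_isSteadyState_gibbsMeasure`; missing: weak-to-semigroup invariance, e.g. via the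
Fokker–Planck uniqueness class or directly from the SDE), Jensen for Markov kernels, `P_tJ ∈ L²(μ_T)`
(Lyapunov moments: `LangevinChainExpBound` gives `P_te^{θH} ≤ e^{C*t}e^{θH}`, enough);
(2) Cauchy–Schwarz — given (1) and integrability, one line;
(3) `F² = 2A + 2B(2·)` — needs DETAILED BALANCE `P_t* = ΘP_tΘ` on `L²(μ_T)` for the constructed
kernels (Haussmann–Pardoux time reversal: the tree has the Lebesgue duality
`LangevinChainReversal.compProd_langevinKernel_eq` for `langevinKernel`; missing: the `μ_T`-weighted,
`Θ`-conjugated version and the bridge `langevinKernel = transitionKernel` for `pinnedChain`, cf.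
`pureQuarticChain_langevinKernel_eq_transitionKernel`);
(4) Fejér positivity — Markov property of the flow (in tree: Chapman–Kolmogorov) + Fubini;
(5) MEMORY `∀ S ∃ N, 0 < M_N ≤ 2A_N(S)` — the one analytic estimate: a propagation / sensitivity
bound for the linearised flow along Gibbs-typical paths (tridiagonal Hessian ⟹ `(√K t)^{2d}/(2d)!`
reach at distance `d`, `K` = local curvature with Gaussian tails under `μ_T`), summed in `L²(μ_T)`.
Each is standard; (1)+(3) are the same two facts the route's OWN support items
(`GibbsSteadyState`, `OddDensityIsCorrector`) rely on, so proving them serves both sides.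
ROADMAP inside the tree's own framework: `ρ = e^{-H/T}` is harmonic for `L̂ + 2γ` (`L̂` = generator
of the reversed drift `-Y`, `(L̂+2γ)ρ = 0` by `Y·∇H = -γ∑_B p_b²`), and the Doob `ρ`-transform of the
reversed kernels `Q_t(x,dy) := e^{2γt}ρ(y)ρ(x)⁻¹P̂_t(x,dy)` has generator `ρ⁻¹(L̂+2γ)(ρ·) = ΘLΘ`
(direct computation: `-L_H + L_OU`); so (i) the Lebesgue duality ALREADY PROVED
(`IsConfining.compProd_langevinKernel_eq`: `dxP_t(x,dy) = e^{2γt}dyP̂_t(y,dx)`) + (ii) a kernel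
identification `Q_t = ΘP_tΘ` (machinery: `PureQuarticKernelIdentification`) + (iii) the bridge
`langevinKernel = transitionKernel` for `pinnedChain` give detailed balance
`∫f·P_tg dμ_T = ∫g·ΘP_tΘf dμ_T`, whence invariance (`f ≡ 1`), contraction, (1)–(3); (4) is Markov +
Fubini; only (5) needs new analysis (a sensitivity/propagation estimate).

## §5 Consequence for the route (repair = the planner's pivot (c))
The witness kills "∫‖·‖dt" (rank 2, and `EngineGlue`'s Minkowski step) and NOTHING ELSE: the
resolvent / corrector form SI′ `‖P_odd ∫₀^∞P_tJ dt‖² = O(N)` (⟺ rank 3 `OddResponseBound` by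
`OddDensityIsCorrector`) integrates in time BEFORE taking the norm, and the locality count is then
harmless (heuristically `P_odd u_N ≈ τ·J`, `‖P_odd u_N‖² ≈ τ²σ²N`). Would-be classification once `H`
lands: `refuted-substantive` for the engine (no side condition repairs "integral of the norm";
tried: restricting to `t ≥ t₀`, weights `w(t)`, `T`-dependence — all killed by the same count since
`A_N(t) ≥ M_N/2` up to `t ≍ N`); repaired crux C′ := SI′ above (a different statement, = rank 3).
barrier-candidate: "NoUniformNormDecayUnderBoundaryNoise" — for boundary-driven chains with
deterministic bulk, no extensive local observable has `N`-uniformly integrable `L²(μ)`-NORM decay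
(memory half-life `≥ cN/v`); technique class hit: parity-sector-semigroup-decay / any
"Minkowski then decay" engine; evasion: time-integrate first (resolvent, corrector, Poisson
equation), or measure decay in seminorms testing finitely many (hydrodynamic) modes.

## §6 Numerical evidence
(a) HARMONIC member `pinnedChain(1,0,0,1)`, `T = 1` — EXACT Gaussian linear algebra (pure python on the
hub, `num/harmonic_purepy.py`, `P_tJ(x) = xᵀe^{tAᵀ}Qe^{tA}x + c_t`, `‖·‖²` = `2tr(RΣRΣ)`), N = 3…16:
* identity `F_N(t)² = 2A_N(t) + 2B_N(2t)`: relative error `≤ 7·10⁻¹⁶` at every `N` — generalised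
  detailed balance `P_t* = ΘP_tΘ` holds in `L²(μ_T)` WITH the bath friction, as claimed in §1.1;
* Fejér positivity: `min_S ∫₀^S(S-u)B_N(u)du = 0` (at `S = 0`) for every `N` (§1.2);
* LOCALITY `A_N(t)/M_N` at fixed `t` (rows `N = 3,4,6,8,10,12,16`):
  `t=1: .41 .57 .71 .79 .83 .86 .89`, `t=2: .10 .31 .54 .66 .73 .77 .83`,
  `t=4: .007 .12 .37 .53 .62 .68 .76`, `t=8: 3e-5 .011 .093 .27 .42 .52 .64` — increasing to `1`;
* memory half-life `t_½(N) = 0.8, 1.25, 2.4, 4.45, 6.4, 8.4, 12.4` ≈ `0.8N - 0.4`: LINEAR in `N`;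
* the crux's ratio `∫₀^{3N+8}F_N dt/√M_N = 2.8, 5.4, 10.8, 16.2, 20.9, 25.9, 35.8`, i.e.
  `/N = 0.94, 1.35, 1.80, 2.02, 2.09, 2.16, 2.24` → linear growth `≈ 2.2N` (`M_N/N → 0.191`).
(b) ANHARMONIC `pinnedChain(1,1,1,1)`, `T = 1` (INSIDE the crux's parameter range) — three-replica
Monte Carlo on the hub (`num/anharmonic_purepy.py` + `num/merge_anh.py`, BAOAB `dt = 0.025`, Gibbs
samples by a full-chain thermostat burn-in, then baths on sites `0, N-1` only; `A_N(t) = E[J(X¹_t)J(X²_t)]`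
with independent bath noises from the same sample, replica 3 from `Θx` for `⟨P_tJ, ΘP_tJ⟩`;
samples `S = 3000, 2000, 1200, 640` for `N = 8, 16, 32, 48`; statistical error on `A/M` ≈ `0.03–0.06`):
* identity `F² = 2A + 2B(2t)` (now a test of detailed balance for the ANHARMONIC chain): mean deviation
  `-0.009, -0.002, +0.07, +0.03` (units of `M_N`), rms `0.03, 0.04, 0.10, 0.08` = MC noise level;
  Fejér minimum `0` at every `N`;
* LOCALITY `A_N(t)/M_N` (rows `N = 8, 16, 32, 48`): `t=2: .67 .82 .88 .93`, `t=4: .44 .69 .84 .93`,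
  `t=8: .10 .49 .73 .86`, `t=16: .00 .09 .48 .64` — increasing to `1` at fixed `t`;
* memory half-life `t_½(N) = 3.5, 8.0, 16.0, 23.25` ≈ `N/2`: LINEAR in `N` (two fronts at ≈ `0.5`
  bond per unit time);
* the FORGETTING FRONT, bond-resolved memory `E[j_z(X¹_t)j_z(X²_t)]/⟨j²⟩`, `N = 32`, bonds `0…30`:
  `t=4:  .42 .39 .51 .79 .69 | bulk 0.9–1.2 | .71 .70 .57 .26`,
  `t=8:  .15 .51 .44 .51 .49 .61 .79 | bulk 0.8–1.2 | .53 .39 .47 .38 .29 .27`,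
  `t=16: .01 .12 .21 .36 .29 .25 .34 .40 .44 .52 | centre .8–.9 | .28 .22 .18 .25 .17 .16`
  — the deep bulk remembers its current PERFECTLY until the front arrives: the light cone of §1.5;
* the crux's ratio, truncated at `t ≤ 1.5N + 4` (a LOWER bound for `∫₀^∞F_N/√M_N`):
  `10.3, 20.3, 41.5, 64.3`, i.e. `/N = 1.28, 1.27, 1.30, 1.34` → LINEAR in `N` (`M_N/N → 0.41`).
(c) kit job j007997 (numpy version of (a)+(b) to `N = 64`, `S = 1000`) was queued behind 3600 jobs and
is superseded by (a)+(b); cancelled.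
The obstruction does not distinguish harmonic from anharmonic: only the SHAPE of `A_N` inside the
causal region differs (phonon escape vs. butterfly front), not `t_½(N) ∝ N`.
-/

noncomputable section

open MeasureTheory Set Filter Topology intervalIntegral
open Literature.MathematicalPhysics.KineticTheory.HeatConduction
open Summit.AtomisticToContinuum.FouriersLaw.Theses.OddSectorIrreversibility (OddCorrectorDecay)
open Literature.MathematicalPhysics.KineticTheory (OddSectorLocalityHypothesis)
open Literature.MathematicalPhysics.KineticTheory.OddSectorLocality

namespace Summit.AtomisticToContinuum.FouriersLaw.Cruxes.OddCorrectorDecay.Disproof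

/-! ### The real-analysis core -/

/-- **Core inequality of the locality obstruction.** Let `F ≥ 0` be integrable on `(0,∞)` with
`∫_{(0,∞)} F ≤ C√M` (`M > 0`), and suppose `F(t)² = 2A(t) + 2B(2t)` for `t > 0` with `A`
non-increasing on `[0,∞)`, `A ≤ M`, `B ≤ M` on `[0,∞)`, and `B` positive-definite in Fejér form at
horizon `2S`: `0 ≤ ∫₀^{2S} (2S-u)B(u)du`. If half of `M` survives in `A` at time `S`
(`M ≤ 2A(S)`), then `S ≤ 4C`. Proof: `F ≤ 2√M`, so
`∫F ≥ ∫₀^S (1-t/S)F ≥ ∫₀^S (1-t/S)F²/(2√M) = (∫₀^S(1-t/S)A + ∫₀^S(1-t/S)B(2·))/√M ≥ (S/2)A(S)/√M`.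
[folklore] -/
theorem horizon_le_of_integrated_odd_decay {F A B : ℝ → ℝ} {M C S : ℝ} (hS : 0 < S) (hM : 0 < M)
    (hFint : IntegrableOn F (Ioi 0))
    (hF0 : ∀ t, 0 ≤ F t)
    (hFsq : ∀ t, 0 < t → F t ^ 2 = 2 * A t + 2 * B (2 * t))
    (hAanti : AntitoneOn A (Ici 0)) (hAle : ∀ t, 0 ≤ t → A t ≤ M)
    (hBle : ∀ u, 0 ≤ u → B u ≤ M)
    (hFejer : 0 ≤ ∫ u in (0:ℝ)..(2 * S), (2 * S - u) * B u)
    (hle : ∫ t in Ioi 0, F t ≤ C * Real.sqrt M)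
    (hmem : M ≤ 2 * A S) :
    S ≤ 4 * C := by
  have hsq : 0 < Real.sqrt M := Real.sqrt_pos.2 hM
  have hsqsq : Real.sqrt M * Real.sqrt M = M := Real.mul_self_sqrt hM.le
  -- (1) `F ≤ 2√M` on `(0,∞)`
  have hFle : ∀ t, 0 < t → F t ≤ 2 * Real.sqrt M := by
    intro t ht
    have hA := hAle t ht.le
    have hB := hBle (2 * t) (by positivity)
    have h1 : F t ^ 2 ≤ 4 * M := by rw [hFsq t ht]; linarith
    nlinarith [hF0 t, hsq, hsqsq]
  -- the Fejér weight `1 - t/S` on `(0, S]`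
  have hw0 : ∀ t ∈ Ioc (0:ℝ) S, 0 ≤ 1 - t / S := fun t ht => by
    have : t / S ≤ 1 := (div_le_one hS).2 ht.2
    linarith
  have hw1 : ∀ t ∈ Ioc (0:ℝ) S, 1 - t / S ≤ 1 := fun t ht => by
    have : 0 ≤ t / S := div_nonneg ht.1.le hS.le
    linarith
  have hwc : Continuous fun t : ℝ => 1 - t / S := by fun_prop
  have hwm : AEStronglyMeasurable (fun t : ℝ => 1 - t / S) (volume.restrict (Ioc 0 S)) :=
    hwc.aestronglyMeasurable
  have hwbd : ∀ᵐ t ∂(volume.restrict (Ioc (0:ℝ) S)), ‖(1 : ℝ) - t / S‖ ≤ 1 := by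
    refine (ae_restrict_mem measurableSet_Ioc).mono fun t ht => ?_
    rw [Real.norm_eq_abs, abs_le]
    constructor <;> linarith [hw0 t ht, hw1 t ht]
  -- pointwise comparison `(1 - t/S) F²/(2√M) ≤ (1 - t/S) F` on `(0, S]`
  have hpt : ∀ t ∈ Ioc (0:ℝ) S,
      (1 - t / S) * F t ^ 2 / (2 * Real.sqrt M) ≤ (1 - t / S) * F t := by
    intro t ht
    have hF := hFle t ht.1
    have h1 : F t ^ 2 / (2 * Real.sqrt M) ≤ F t := by
      rw [div_le_iff₀ (by positivity)]
      nlinarith [hF0 t]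
    calc (1 - t / S) * F t ^ 2 / (2 * Real.sqrt M)
        = (1 - t / S) * (F t ^ 2 / (2 * Real.sqrt M)) := by ring
      _ ≤ (1 - t / S) * F t := mul_le_mul_of_nonneg_left h1 (hw0 t ht)
  -- integrability bookkeeping
  have hI1 : IntegrableOn F (Ioc 0 S) := hFint.mono_set Ioc_subset_Ioi_self
  have hI2 : IntegrableOn (fun t => (1 - t / S) * F t) (Ioc 0 S) := hI1.bdd_mul hwm hwbd
  have hI3 : IntegrableOn (fun t => (1 - t / S) * F t ^ 2 / (2 * Real.sqrt M)) (Ioc 0 S) := by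
    refine Integrable.mono' hI2 ?_ ?_
    · have hFam : AEMeasurable F (volume.restrict (Ioc 0 S)) := hI1.aestronglyMeasurable.aemeasurable
      have hm : AEMeasurable (fun t => (1 - t / S) * F t ^ 2 / (2 * Real.sqrt M))
          (volume.restrict (Ioc 0 S)) := by fun_prop
      exact hm.aestronglyMeasurable
    · refine (ae_restrict_mem measurableSet_Ioc).mono fun t ht => ?_
      rw [Real.norm_eq_abs, abs_of_nonneg (by have := hw0 t ht; have := hF0 t; positivity)]
      exact hpt t ht
  have hAint : IntegrableOn A (Icc 0 S) :=
    (hAanti.mono Icc_subset_Ici_self).integrableOn_isCompact isCompact_Icc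
  have hI4 : IntegrableOn (fun t => (1 - t / S) * A t) (Ioc 0 S) :=
    (IntegrableOn.continuousOn_mul hwc.continuousOn hAint isCompact_Icc).mono_set Ioc_subset_Icc_self
  have hI5 : IntegrableOn (fun t => (1 - t / S) * B (2 * t)) (Ioc 0 S) := by
    have h : EqOn (fun t => (1 - t / S) * F t ^ 2 / (2 * Real.sqrt M) * Real.sqrt M - (1 - t / S) * A t)
        (fun t => (1 - t / S) * B (2 * t)) (Ioc 0 S) := by
      intro t ht
      beta_reduce
      rw [hFsq t ht.1]
      field_simp
      ring
    have h' : IntegrableOn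
        (fun t => (1 - t / S) * F t ^ 2 / (2 * Real.sqrt M) * Real.sqrt M - (1 - t / S) * A t)
        (Ioc 0 S) := (hI3.mul_const _).sub hI4
    exact h'.congr_fun h measurableSet_Ioc
  -- (2) `∫_{(0,S]} (1 - t/S) F ≤ ∫_{(0,∞)} F`
  have h2 : ∫ t in Ioc 0 S, (1 - t / S) * F t ≤ ∫ t in Ioi 0, F t := by
    calc ∫ t in Ioc 0 S, (1 - t / S) * F t ≤ ∫ t in Ioc 0 S, F t :=
          setIntegral_mono_on hI2 hI1 measurableSet_Ioc fun t ht => by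
            have := hw1 t ht
            have := hF0 t
            nlinarith
      _ ≤ ∫ t in Ioi 0, F t :=
          setIntegral_mono_set hFint (Filter.Eventually.of_forall fun t => hF0 t)
            Ioc_subset_Ioi_self.eventuallyLE
  -- (3) `∫ (1 - t/S) F²/(2√M) ≤ ∫ (1 - t/S) F`
  have h3 : ∫ t in Ioc 0 S, (1 - t / S) * F t ^ 2 / (2 * Real.sqrt M)
      ≤ ∫ t in Ioc 0 S, (1 - t / S) * F t :=
    setIntegral_mono_on hI3 hI2 measurableSet_Ioc hpt
  -- (4) split `F² = 2A + 2B(2·)`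
  have h4 : ∫ t in Ioc 0 S, (1 - t / S) * F t ^ 2 / (2 * Real.sqrt M)
      = ((∫ t in Ioc 0 S, (1 - t / S) * A t) + ∫ t in Ioc 0 S, (1 - t / S) * B (2 * t)) /
          Real.sqrt M := by
    rw [← integral_add hI4 hI5, ← MeasureTheory.integral_div]
    refine setIntegral_congr_fun measurableSet_Ioc fun t ht => ?_
    rw [hFsq t ht.1]
    field_simp
  -- (5) the `A` part: `A S · S/2 ≤ ∫ (1 - t/S) A`
  have hlin : ∫ t in (0:ℝ)..S, (1 - t / S) = S / 2 := by
    rw [intervalIntegral.integral_sub intervalIntegrable_const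
        ((by fun_prop : Continuous fun t : ℝ => t / S).intervalIntegrable _ _),
      intervalIntegral.integral_const, intervalIntegral.integral_div, integral_id]
    field_simp
    ring
  have h5 : A S * (S / 2) ≤ ∫ t in Ioc 0 S, (1 - t / S) * A t := by
    have hc : ∫ t in Ioc 0 S, (1 - t / S) * A S = A S * (S / 2) := by
      rw [← intervalIntegral.integral_of_le hS.le, intervalIntegral.integral_mul_const, hlin]
      ring
    rw [← hc]
    refine setIntegral_mono_on ?_ hI4 measurableSet_Ioc fun t ht => ?_
    · exact ((hwc.mul continuous_const).integrableOn_Icc).mono_set Ioc_subset_Icc_self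
    · exact mul_le_mul_of_nonneg_left
        (hAanti (show t ∈ Ici (0:ℝ) from ht.1.le) (show S ∈ Ici (0:ℝ) from hS.le) ht.2) (hw0 t ht)
  -- (6) the `B` part is `≥ 0` (Fejér positivity after `u = 2t`)
  have h6 : 0 ≤ ∫ t in Ioc 0 S, (1 - t / S) * B (2 * t) := by
    rw [← intervalIntegral.integral_of_le hS.le]
    have h2S := intervalIntegral.integral_comp_mul_left (a := (0:ℝ)) (b := S)
      (fun u => (2 * S)⁻¹ * ((2 * S - u) * B u)) (two_ne_zero)
    simp only [mul_zero, smul_eq_mul] at h2S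
    have key : ∫ t in (0:ℝ)..S, (1 - t / S) * B (2 * t)
        = ∫ t in (0:ℝ)..S, (2 * S)⁻¹ * ((2 * S - 2 * t) * B (2 * t)) :=
      intervalIntegral.integral_congr fun t _ => by
        field_simp
    rw [key, h2S, intervalIntegral.integral_const_mul]
    exact mul_nonneg (by norm_num) (mul_nonneg (by positivity) hFejer)
  -- (7) assemble
  have h7 : A S * (S / 2) / Real.sqrt M ≤ C * Real.sqrt M := by
    calc A S * (S / 2) / Real.sqrt M
        ≤ ((∫ t in Ioc 0 S, (1 - t / S) * A t) + ∫ t in Ioc 0 S, (1 - t / S) * B (2 * t)) /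
            Real.sqrt M := by
          gcongr
          linarith
      _ = ∫ t in Ioc 0 S, (1 - t / S) * F t ^ 2 / (2 * Real.sqrt M) := h4.symm
      _ ≤ ∫ t in Ioc 0 S, (1 - t / S) * F t := h3
      _ ≤ ∫ t in Ioi 0, F t := h2
      _ ≤ C * Real.sqrt M := hle
  have h8 : M / 2 * (S / 2) / Real.sqrt M ≤ C * Real.sqrt M := by
    refine le_trans ?_ h7
    gcongr
    linarith
  have h9 : M / 2 * (S / 2) / Real.sqrt M = S / 4 * Real.sqrt M := by
    rw [div_eq_iff hsq.ne']
    nlinarith [hsqsq]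
  rw [h9] at h8
  have := le_of_mul_le_mul_right h8 hsq
  linarith

/-! ### The crux through the Literature objects -/

/-- The crux, restated through `OddSectorLocality.oddPartNormSq` / `currentNormSq` (definitional).
[folklore] -/
theorem oddCorrectorDecay_iff :
    OddCorrectorDecay ↔
      ∀ ω₂ lam β γ : ℝ, 0 < ω₂ → 0 < lam → 0 < β → 0 < γ → ∀ T : ℝ, 0 < T → ∃ C : ℝ, ∀ N : ℕ,
        IntegrableOn (fun t : ℝ => Real.sqrt (oddPartNormSq ω₂ lam β γ T N t)) (Ioi 0) ∧
          ∫ t in Ioi (0:ℝ), Real.sqrt (oddPartNormSq ω₂ lam β γ T N t) ≤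
            C * Real.sqrt (currentNormSq ω₂ lam β γ T N) :=
  Iff.rfl

/-! ### The negative lemma, with the dictionary and the memory as explicit hypotheses -/

/-- **`OddCorrectorDecay` is false given, at ONE admissible parameter point, the `L²(μ_T)`
dictionary of the equilibrium open chain and fixed-time memory.** The four dictionary hypotheses,
for the length `N` supplied by the memory hypothesis: (1) `t ↦ A_N(t) = ‖P_tJ‖²` is non-increasing
on `[0,∞)` (invariance of the Gibbs weight under `P_t` + Jensen)
[cite: BonettoLebowitzReyBellet2000, §4.1]; (2) `B_N(u) ≤ M_N` (Cauchy–Schwarz + contraction);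
(3) the odd-norm identity `F_N(t)² = 2A_N(t) + 2B_N(2t)` (`Θ`-invariance of `μ_T`, `J∘Θ = -J`,
generalised detailed balance `P_t* = ΘP_tΘ` [cite: KunduDharNarayan2009, eq. (reln2)]);
(4) Fejér positivity of the stationary autocovariance, `0 ≤ ∫₀^S (S-u)B_N(u)du`. Memory:
`0 < M_N ≤ 2A_N(S)` at the horizon `S = 4 max(C,0) + 4` built from the crux's constant — so the
statement is applied through `oddCorrectorDecay_false_of_oddSectorLocalityHypothesis` below, where
the memory hypothesis provides `N` for every horizon. Proof: the core inequality gives `S ≤ 4C < S`.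
[folklore] -/
theorem oddCorrectorDecay_false_of_dictionary_of_memory {ω₂ lam β γ T : ℝ} (hω : 0 < ω₂)
    (hl : 0 < lam) (hβ : 0 < β) (hγ : 0 < γ) (hT : 0 < T)
    (hD : ∀ N : ℕ,
      AntitoneOn (forecastNormSq ω₂ lam β γ T N) (Ici 0) ∧
      (∀ u : ℝ, 0 ≤ u → currentAutocorr ω₂ lam β γ T N u ≤ currentNormSq ω₂ lam β γ T N) ∧
      (∀ t : ℝ, 0 ≤ t → oddPartNormSq ω₂ lam β γ T N t =
        2 * forecastNormSq ω₂ lam β γ T N t + 2 * currentAutocorr ω₂ lam β γ T N (2 * t)) ∧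
      (∀ S : ℝ, 0 < S → 0 ≤ ∫ u in (0:ℝ)..S, (S - u) * currentAutocorr ω₂ lam β γ T N u))
    (hMem : ∀ S : ℝ, 0 < S → ∃ N : ℕ, 0 < currentNormSq ω₂ lam β γ T N ∧
      currentNormSq ω₂ lam β γ T N ≤ 2 * forecastNormSq ω₂ lam β γ T N S) :
    ¬ OddCorrectorDecay := by
  intro hOSD
  obtain ⟨C, hC⟩ := (oddCorrectorDecay_iff.1 hOSD) ω₂ lam β γ hω hl hβ hγ T hT
  set S : ℝ := 4 * max C 0 + 4 with hSdef
  have hmax : 0 ≤ max C 0 := le_max_right _ _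
  have hS : 0 < S := by rw [hSdef]; linarith
  obtain ⟨N, hMpos, hmem⟩ := hMem S hS
  obtain ⟨hint, hle⟩ := hC N
  obtain ⟨hanti, hB, hid, hfejer⟩ := hD N
  have hAle : ∀ t : ℝ, 0 ≤ t → forecastNormSq ω₂ lam β γ T N t ≤ currentNormSq ω₂ lam β γ T N := by
    intro t ht
    rw [← forecastNormSq_zero hω hl.le hβ.le hγ.le T N]
    exact hanti (mem_Ici.2 le_rfl) (mem_Ici.2 ht) ht
  have hodd0 : ∀ t : ℝ, 0 ≤ oddPartNormSq ω₂ lam β γ T N t :=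
    fun t => integral_nonneg fun x => sq_nonneg _
  have key := horizon_le_of_integrated_odd_decay
    (F := fun t => Real.sqrt (oddPartNormSq ω₂ lam β γ T N t))
    (A := forecastNormSq ω₂ lam β γ T N) (B := currentAutocorr ω₂ lam β γ T N)
    hS hMpos hint (fun t => Real.sqrt_nonneg _)
    (fun t ht => by rw [Real.sq_sqrt (hodd0 t), hid t ht.le]) hanti hAle hB
    (hfejer (2 * S) (by positivity)) hle hmem
  have hC' : C ≤ max C 0 := le_max_left _ _
  linarith

/-! ### The negative lemma modulo `H` -/

/-- **Negative lemma (modulo `H`):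
`Literature.MathematicalPhysics.KineticTheory.OddSectorLocalityHypothesis → ¬ OddCorrectorDecay`.**
[folklore] -/
theorem oddCorrectorDecay_false_of_oddSectorLocalityHypothesis
    (h : Literature.MathematicalPhysics.KineticTheory.OddSectorLocalityHypothesis) :
    ¬ OddCorrectorDecay := by
  obtain ⟨ω₂, lam, β, γ, T, hω, hl, hβ, hγ, hT, hD, hMem⟩ := h
  exact oddCorrectorDecay_false_of_dictionary_of_memory hω hl hβ hγ hT hD hMem

/-! ### (b) Tightness: any admissible constant is at least a quarter of the memory half-life -/

/-- **Quantitative form, one length at a time.** If the crux's inequality holds at length `N` with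
constant `C`, the dictionary (1)–(4) holds at `N`, `M_N > 0`, and half of `M_N` is still remembered
at time `S` (`M_N ≤ 2A_N(S)`), then `S ≤ 4C`: every admissible `C(T)` dominates a quarter of the
HALF-LIFE `t_½(N) = sup {S : A_N(S) ≥ M_N/2}` of the `L²(μ_T)`-memory of the total current, for
EVERY `N`. Numerically `t_½(N) ≈ N/2` for `pinnedChain(1,1,1,1)` at `T = 1` (§6(b)), so
`C ≳ N/8 → ∞`. [folklore] -/
theorem horizon_le_four_mul_constant {ω₂ lam β γ T : ℝ} (hω : 0 < ω₂) (hl : 0 ≤ lam) (hβ : 0 ≤ β)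
    (hγ : 0 ≤ γ) {N : ℕ} {C S : ℝ} (hS : 0 < S)
    (hint : IntegrableOn (fun t : ℝ => Real.sqrt (oddPartNormSq ω₂ lam β γ T N t)) (Ioi 0))
    (hle : ∫ t in Ioi (0:ℝ), Real.sqrt (oddPartNormSq ω₂ lam β γ T N t) ≤
      C * Real.sqrt (currentNormSq ω₂ lam β γ T N))
    (hanti : AntitoneOn (forecastNormSq ω₂ lam β γ T N) (Ici 0))
    (hB : ∀ u : ℝ, 0 ≤ u → currentAutocorr ω₂ lam β γ T N u ≤ currentNormSq ω₂ lam β γ T N)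
    (hid : ∀ t : ℝ, 0 ≤ t → oddPartNormSq ω₂ lam β γ T N t =
      2 * forecastNormSq ω₂ lam β γ T N t + 2 * currentAutocorr ω₂ lam β γ T N (2 * t))
    (hfejer : ∀ S : ℝ, 0 < S → 0 ≤ ∫ u in (0:ℝ)..S, (S - u) * currentAutocorr ω₂ lam β γ T N u)
    (hMpos : 0 < currentNormSq ω₂ lam β γ T N)
    (hmem : currentNormSq ω₂ lam β γ T N ≤ 2 * forecastNormSq ω₂ lam β γ T N S) :
    S ≤ 4 * C := by
  have hAle : ∀ t : ℝ, 0 ≤ t → forecastNormSq ω₂ lam β γ T N t ≤ currentNormSq ω₂ lam β γ T N := by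
    intro t ht
    rw [← forecastNormSq_zero hω hl hβ hγ T N]
    exact hanti (mem_Ici.2 le_rfl) (mem_Ici.2 ht) ht
  have hodd0 : ∀ t : ℝ, 0 ≤ oddPartNormSq ω₂ lam β γ T N t :=
    fun t => integral_nonneg fun x => sq_nonneg _
  exact horizon_le_of_integrated_odd_decay
    (F := fun t => Real.sqrt (oddPartNormSq ω₂ lam β γ T N t))
    (A := forecastNormSq ω₂ lam β γ T N) (B := currentAutocorr ω₂ lam β γ T N)
    hS hMpos hint (fun t => Real.sqrt_nonneg _)
    (fun t ht => by rw [Real.sq_sqrt (hodd0 t), hid t ht.le]) hanti hAle hB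
    (hfejer (2 * S) (by positivity)) hle hmem

/-! ### (e) Near-miss: the unconditional negation -/

/-- **NEAR-MISS (the only `sorry` of this work file): the unconditional `¬ OddCorrectorDecay`.**
Obstruction = `H` itself (§4): discharge `OddSectorLocalityHypothesis` — (1)–(3) via the tree's
Lebesgue duality + the Doob `e^{-H/T}`-transform identification `Q_t = ΘP_tΘ` + the bridge
`langevinKernel = transitionKernel`; (4) Markov + Fubini; (5) a sensitivity/propagation estimate for
the linearised flow under `μ_T ⊗ Wiener` — then this is
`oddCorrectorDecay_false_of_oddSectorLocalityHypothesis h`. Tried here: nothing cheaper exists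
(no junk/degenerate escape, §0; every `_false_without_` needs the same dictionary, §3). -/
theorem not_oddCorrectorDecay : ¬ OddCorrectorDecay := by
  have h : OddSectorLocalityHypothesis := by
    sorry
  exact oddCorrectorDecay_false_of_oddSectorLocalityHypothesis h

end Summit.AtomisticToContinuum.FouriersLaw.Cruxes.OddCorrectorDecay.Disproof
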